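import Summits.BirchSwinnertonDyer.BirchSwinnertonDyer.Theorems.SignedLowerHalvesKobayashiLowerHalfLargeImageLambdaTwoStratumOddPrime
import Literature.NumberTheory.EllipticCurves.BoxerDiao2010.TamagawaTwistHolds
import Summits.BirchSwinnertonDyer.Rank1Residual.Supersingular.MazurTateCertificates
import HarnessLib

/-!
# Route `SignedLowerHalves`, crux 3 `KobayashiLowerHalfLargeImage` (item stmt-BirchSwinnertonDyer-19001):
# the `λ = 2` STRATUM, part 6 — the X7 ∩ {`r_an = 0`} road to `BSD(E,p)` at any odd `p` and the `p = 3`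
# READINGS of part 5 (the `3 ∣ c_q` rows, the stub's binder shape, records-level Mazur–Tate forms), all with
# the algebraic functional equation DISPLAYED per pair (cell `bsd-ssimc`, width seat `bsd-line-slh-p1-w6`
# gen 2; helper file `--supports 19001`; CALIBRATION / SUPPORT ONLY, pen rule D34-4 (3))

HONEST FRAMING: the crux and the line-of-record stub `KuriharaRigidity.stub_three` are OPEN and nothing
here proves them; BSD is not proved by any of this. THEOREMS ONLY, CONDITIONAL on DISPLAYED binders —
the PUBLISHED named facts `h12`, `h41` (Kobayashi 2003 Thm. 1.2 / 4.1), `h5`, `h3` (period units), `hL20`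
(Wuthrich 2014 Lemma 20), `hK13` (B. D. Kim 2013 Cor. 3.15), `hpar` (`p`-parity), `hGZK`, `hW`/`hmod`/`hmod'`
(Wuthrich Prop. 21 / modularity, for the `BSDp` road) — and ONE per-pair algebraic hypothesis `hAFE`: the
algebraic functional equation `ι(Char X^ε) = Char X^ε` of `Sel^ε(E/ℚ_∞)` at `(W, p, ε)`, VERBATIM the body
of B. D. Kim 2008 Thm. 3.12 with its `3 < p` removed (a named fact of the tree supplies it at `p > 3`,
part 5 `afe_of_thm312`; at `p = 3` it is a HYPOTHESIS / typing request — see part 5's module docstring).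
Nothing is asserted about any curve; nothing is booked; PER PAIR throughout.

## What this file does

* §1 `X7.bsdp_of_lam_eq_two_of_dvd_tamagawa_of_analyticRank_eq_zero_of_afe` — X7 ∩ {`r_an = 0`}, any
  odd `p`, `ρ̄` onto, `p ∣ ∏ c_ℓ`, certificate `(μ, λ)(L_p^ε) = (0, 2)`, `hAFE` ⇒ Miller's `BSDp W p`
  (part 5's rank-zero corollary through the tree's road
  `X7.bsdp_of_kobayashiLowerDivisibility_of_surj_of_analyticRank_eq_zero`; at `p ≥ 5` with Kim's fact
  this is part 4's `X7.bsdp_of_lam_eq_two_of_dvd_tamagawa_of_analyticRank_eq_zero`).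
* §2 `p = 3`: `three_dvd_tamagawaProduct_of_dvd_localTamagawaNumber` (`3 ∣ c_q ⇒ 3 ∣ Tam(E)`, from the
  tree's `BoxerDiao2010.localTamagawaNumber_padic_dvd_tamagawaProduct`); the STUB'S BINDER SHAPE
  `X7.exists_kobayashiLowerDivisibility_three_of_lam_eq_two_of_imp_of_afe` (`p = 3`, X7, `¬CM`, `a_3 = 0`,
  `Surj W 3` + per-pair data ⇒ `∃ ε, KobayashiLowerDivisibility W p ε`); the `3 ∣ c_q`, `r_an = 0` rows
  (`kobayashiMainConjecture_three_…`, `X7.bsdp_three_…`). WHY `p = 3` MATTERS HERE: at `p = 3` the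
  Tamagawa bit `3 ∣ ∏ c_ℓ` is met not only at split multiplicative primes with `3 ∣ ord_ℓ(Δ)` but at every
  ADDITIVE prime of Kodaira type `IV`/`IV*` with `c_q = 3` — exactly the non-split «shadow primes» of the
  crux directory's line `Lines/shadow_seed.lean` (`IsShadowPrimeAt`: `c_q = 3` when `q ≡ 2 (mod 3)`; all
  26 census pairs of `K1G18-SEARCH-LOG.md` carry one, `Lines/shadow-seed-L0-w2g7.md`). On the `r_an = 0`
  rows of that population with a signed certificate `(0, 2)`, Kobayashi's main conjecture (hence the stub's
  conclusion and `BSD(E,3)`) follows from PUBLISHED facts plus `hAFE` at `(E, 3, ε)` — no Fouquet–Wan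
  binder, no level lowering, no Kurihara number (compare `ShadowSeed.ShadowSeedTransport_OPEN`, whose
  non-published link is Fouquet–Wan 2021 Thm. 5.1).
* §3 records-level forms at any odd `p` (the certificate as ONE Mazur–Tate element, `λ(θ_n) = deg ω_n^± + 2`,
  via `lam_signed_neg_one/one_eq_of_mazurTate'`, `p` odd).

References: [Kobayashi2003] Thm. 1.2, Thm. 4.1, Conjecture (p. 2), (3.6); [KimBD2008MRL] Thm. 3.12, p. 83;
[BDKim2013] Cor. 3.15; [Wuthrich2014] Lemma 20, Prop. 21; [Darmon2004] Thm. 3.22; [Pollack2003] Prop. 6.9,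
6.10, 6.18; [SilvermanAEC2009] Cor. VII.6.2; [Miller2011LMS] Def. 1.1; [FouquetWan2021] Thm. 5.1 (PRE, for
comparison only). Crux dir: `Lines/shadow_seed.lean`, `K1G18-SEARCH-LOG.md`, `LineReportKuriharaRigidity.md` v9.
-/

set_option autoImplicit false
set_option linter.dupNamespace false

noncomputable section

open scoped Classical MatrixGroups ModularForm

open CongruenceSubgroup PowerSeries WeierstrassCurve Literature.NumberTheory.EllipticCurves
  Literature.NumberTheory.EllipticCurves.ModularForms Literature.Barriers.BirchSwinnertonDyer
  Literature.NumberTheory.EllipticCurves.Rank1Residual Literature.NumberTheory.EllipticCurves.Sprung2017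
  Literature.NumberTheory.EllipticCurves.Kobayashi2003 ZpExtension
  Literature.NumberTheory.EllipticCurves.Rank1Residual.Typed
  Summit.BirchSwinnertonDyer.Rank1Residual Summit.BirchSwinnertonDyer.Rank1Residual.X1.MuLambda
  Summit.BirchSwinnertonDyer.Rank1Residual.Supersingular
  Summit.BirchSwinnertonDyer.BirchSwinnertonDyer.Theorems.LargeImageParityStratum

namespace Summit.BirchSwinnertonDyer.BirchSwinnertonDyer.Theorems.LargeImageLambdaTwoStratum

/-! ## §1. X7 ∩ {`r_an = 0`}: Miller's `BSD(E, p)` at any odd `p` -/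

section RankZeroOdd

variable (W : WeierstrassCurve ℚ) [W.IsElliptic] [W.IsGloballyMinimal] (p : ℕ) [Fact p.Prime]

/-- **X7 ∩ {`r_an = 0`}, any odd `p`, `ρ̄` onto, `p ∣ ∏ c_ℓ`, certificate `(μ, λ)(L_p^ε) = (0, 2)`, `hAFE`
at the pair: Miller's `BSD(E, p)`** — part 5's rank-zero corollary read through the tree's X7 rank-zero road
`X7.bsdp_of_kobayashiLowerDivisibility_of_surj_of_analyticRank_eq_zero` (Wuthrich Prop. 21 under `Surj`,
Kim Cor. 3.15, Pollack's theorem DISCHARGED by `pollack_exists_plusMinusPAdicLFunction_holds`, modularity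
`hmod`/`hmod'`, GZK). At `p = 3` the class X7 does not force `a_3 = 0`, hence the explicit `hap`. PER PAIR
`h0`, `hdvd`, `hcert₀`, `hAFE`. [cite: Wuthrich2014, Prop. 21 (p. 400)] [cite: Miller2011LMS, Def. 1.1]
[cite: Kobayashi2003, Thm. 1.2, Thm. 4.1, (3.6)] [cite: KimBD2008MRL, Thm. 3.12 (p. 93)] [cite: BDKim2013, Cor. 3.15 (p. 199)] -/
theorem X7.bsdp_of_lam_eq_two_of_dvd_tamagawa_of_analyticRank_eq_zero_of_afe
    (hW : Wuthrich2014.sha_dvd_analyticSha)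
    (h12 : Kobayashi2003.thm12_signedSelmerDual_finite_torsion)
    (h41 : Kobayashi2003.thm41_signedCharIdeal_divisibility)
    (h5 : realPeriodRat_eq_unit_mul_plusPeriod) (h3 : realPeriodRat_eq_unit_mul_plusPeriod_three)
    (hL20 : Wuthrich2014.lemma20_surjective_threeAdic_of_semistable)
    (hK13 : BDKim2013.cor315_signedCharValue_rankZero)
    (hmod : nonempty_modularParametrizationData) (hmod' : hasEntireLFunction_rat)
    (hGZK : rank_eq_analyticRank_of_analyticRank_le_one)
    (hp : p ≠ 2) (hX : ClassX7 W p) (hap : W.frobeniusTrace p = 0) (hs : Surj W p) {ε : ℤˣ}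
    (hAFE : ∀ (κ : ZpExtension ℚ p) (γ : Field.absoluteGaloisGroup ℚ), κ.IsCyclotomic →
      κ.IsTopGenerator γ → ∀ D : SignedSelmerDualData W κ γ ε,
        Ideal.map (IwasawaAlgebra.invol p) D.charIdeal = D.charIdeal)
    [NeZero (W.conductorNorm ℤ)] {f₀ : CuspForm (Gamma0 (W.conductorNorm ℤ)) 2} (hf₀ : IsNewformOf W f₀)
    (hcert₀ : ∀ L : IwasawaAlgebra p, IsSignedPAdicLFunction f₀ p ε L → mu L = 0 ∧ lam L = 2)
    (h0 : W.analyticRank = 0) (hdvd : p ∣ W.tamagawaProduct) : BSDp W p :=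
  X7.bsdp_of_kobayashiLowerDivisibility_of_surj_of_analyticRank_eq_zero W p hW h12 hK13
    (fun {_} _ {_} ↦ pollack_exists_plusMinusPAdicLFunction_holds) hmod hmod' hGZK hp hX hap hs h0
    (kobayashiLowerDivisibility_of_mainConjecture
      (kobayashiMainConjecture_of_lam_eq_two_of_dvd_tamagawa_of_analyticRank_eq_zero_of_afe W p h12 h41
        h5 h3 hL20 hK13 hGZK hp hX.1.1 hap hs ε hAFE hf₀ hcert₀ h0 hdvd))

end RankZeroOdd

/-! ## §2. `p = 3` readings for the line-of-record stub `KuriharaRigidity.stub_three` -/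

section Three

variable (W : WeierstrassCurve ℚ) [W.IsElliptic] [W.IsGloballyMinimal]

omit [W.IsGloballyMinimal] in
/-- `c_q ∣ ∏_v c_v` at a rational prime `q` (bookkeeping, from the tree's
`BoxerDiao2010.localTamagawaNumber_padic_dvd_tamagawaProduct`): a bad prime `q` with `3 ∣ c_q` — e.g. an
additive prime of Kodaira type `IV` or `IV*` with `c_q = 3`, the non-split «shadow primes» of
`Lines/shadow_seed.lean` — puts the curve on the `3 ∣ Tam(E)` rows. [cite: SilvermanAEC2009, Cor. VII.6.2] -/
theorem three_dvd_tamagawaProduct_of_dvd_localTamagawaNumber (q : ℕ) [Fact q.Prime]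
    (hq : 3 ∣ (W.baseChange ℚ_[q]).localTamagawaNumber ℤ_[q]) : 3 ∣ W.tamagawaProduct :=
  hq.trans (BoxerDiao2010.localTamagawaNumber_padic_dvd_tamagawaProduct W q)

/-- **`p = 3`, the stub's binder shape.** On the class of `KuriharaRigidity.stub_three` (`p = 3`, X7,
`¬CM`, `a_3 = 0`, `Surj W 3`) and at a pair carrying: a signed certificate `(μ, λ)(L_3^ε) = (0, 2)` for the
newform of level `N_E` and ONE sign `ε`, the residual bit «`Sel_{3^∞}(E/ℚ)` finite ⇒
`3 ∣ ∏ c_ℓ · #Sel_{3^∞}(E/ℚ)`», and the algebraic functional equation of `Sel^ε(E/ℚ_∞)` at `(E, 3, ε)`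
(`hAFE`) — the stub's conclusion `∃ ε, KobayashiLowerDivisibility W p ε` holds, GRANTED the PUBLISHED
facts `h12`, `h41`, `h5`, `h3`, `hL20`, `hK13`, `hpar`. No Fouquet–Wan binder, no level lowering, no
Kurihara number; the μ-part is not even needed on this branch. PER PAIR; the stub (a class statement)
is NOT proved. [cite: Kobayashi2003, Conjecture (Main Conjecture) (p. 2)] [cite: KimBD2008MRL, Thm. 3.12 (p. 93)]
[cite: BDKim2013, Cor. 3.15 (p. 199)] [cite: Wuthrich2014, Lemma 20 (p. 399)] -/
theorem X7.exists_kobayashiLowerDivisibility_three_of_lam_eq_two_of_imp_of_afe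
    (h12 : Kobayashi2003.thm12_signedSelmerDual_finite_torsion)
    (h41 : Kobayashi2003.thm41_signedCharIdeal_divisibility)
    (h5 : realPeriodRat_eq_unit_mul_plusPeriod) (h3 : realPeriodRat_eq_unit_mul_plusPeriod_three)
    (hL20 : Wuthrich2014.lemma20_surjective_threeAdic_of_semistable)
    (hK13 : BDKim2013.cor315_signedCharValue_rankZero)
    (p : ℕ) [Fact p.Prime] (hp3 : p = 3) (hpar : p_parity W p)
    (hX : ClassX7 W p) (hCM : ¬ W.HasCM) (hap : W.frobeniusTrace p = 0) (hs : Surj W p)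
    [NeZero (W.conductorNorm ℤ)] {f₀ : CuspForm (Gamma0 (W.conductorNorm ℤ)) 2} (hf₀ : IsNewformOf W f₀)
    {ε : ℤˣ} (hcert₀ : ∀ L : IwasawaAlgebra p, IsSignedPAdicLFunction f₀ p ε L → mu L = 0 ∧ lam L = 2)
    (hAFE : ∀ (κ : ZpExtension ℚ p) (γ : Field.absoluteGaloisGroup ℚ), κ.IsCyclotomic →
      κ.IsTopGenerator γ → ∀ D : SignedSelmerDualData W κ γ ε,
        Ideal.map (IwasawaAlgebra.invol p) D.charIdeal = D.charIdeal)
    (hres : Finite (W.selmerGroupPInfty p) → p ∣ W.tamagawaProduct * Nat.card (W.selmerGroupPInfty p)) :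
    ∃ ε : ℤˣ, KobayashiLowerDivisibility W p ε :=
  X7.exists_kobayashiLowerDivisibility_of_lam_eq_two_of_imp_of_afe W p h12 h41 h5 h3 hL20 hK13 hpar
    (by omega) hX hCM hap hs hf₀ hcert₀ hAFE hres

/-- **`p = 3`, analytic rank `0`, a bad prime `q` with `3 ∣ c_q`** (so `3 ∣ Tam(E)`; e.g. a non-split
shadow prime): at a good supersingular `3` with `a_3 = 0` and `ρ̄_{E,3}` onto, a signed certificate
`(0, 2)` and `hAFE` at `(E, 3, ε)` give Kobayashi's main conjecture for `(E, 3, ε)`, granted `h12`,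
`h41`, `h5`, `h3`, `hL20`, `hK13`, `hGZK` (PUBLISHED). The `shadow-seed` population of the crux
directory (26 off-locus `Surj` window pairs at `3`, all with a shadow prime of `c_q = 3`, `K1G18`) meets
`hq`; on its `r_an = 0 ∧ λ = 2` rows this is a road with NO preprint binder.
[cite: Kobayashi2003, Thm. 1.2, Thm. 4.1 and Conjecture (p. 2)] [cite: BDKim2013, Cor. 3.15 (p. 199)]
[cite: Darmon2004, Thm. 3.22] [cite: SilvermanAEC2009, Cor. VII.6.2] [cite: KimBD2008MRL, Thm. 3.12 (p. 93)] -/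
theorem kobayashiMainConjecture_three_of_lam_eq_two_of_dvd_localTamagawa_of_analyticRank_eq_zero_of_afe
    (h12 : Kobayashi2003.thm12_signedSelmerDual_finite_torsion)
    (h41 : Kobayashi2003.thm41_signedCharIdeal_divisibility)
    (h5 : realPeriodRat_eq_unit_mul_plusPeriod) (h3 : realPeriodRat_eq_unit_mul_plusPeriod_three)
    (hL20 : Wuthrich2014.lemma20_surjective_threeAdic_of_semistable)
    (hK13 : BDKim2013.cor315_signedCharValue_rankZero)
    (hGZK : rank_eq_analyticRank_of_analyticRank_le_one)
    [Fact (Nat.Prime 3)] (hgood : W.HasGoodReductionAtPrime 3) (hap : W.frobeniusTrace 3 = 0)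
    (hs : Surj W 3) (ε : ℤˣ)
    (hAFE : ∀ (κ : ZpExtension ℚ 3) (γ : Field.absoluteGaloisGroup ℚ), κ.IsCyclotomic →
      κ.IsTopGenerator γ → ∀ D : SignedSelmerDualData W κ γ ε,
        Ideal.map (IwasawaAlgebra.invol 3) D.charIdeal = D.charIdeal)
    [NeZero (W.conductorNorm ℤ)] {f₀ : CuspForm (Gamma0 (W.conductorNorm ℤ)) 2} (hf₀ : IsNewformOf W f₀)
    (hcert₀ : ∀ L : IwasawaAlgebra 3, IsSignedPAdicLFunction f₀ 3 ε L → mu L = 0 ∧ lam L = 2)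
    (h0 : W.analyticRank = 0)
    (q : ℕ) [Fact q.Prime] (hq : 3 ∣ (W.baseChange ℚ_[q]).localTamagawaNumber ℤ_[q]) :
    KobayashiMainConjecture W 3 ε :=
  kobayashiMainConjecture_of_lam_eq_two_of_dvd_tamagawa_of_analyticRank_eq_zero_of_afe W 3 h12 h41 h5 h3
    hL20 hK13 hGZK (by decide) hgood hap hs ε hAFE hf₀ hcert₀ h0
    (three_dvd_tamagawaProduct_of_dvd_localTamagawaNumber W q hq)

/-- **`p = 3`, X7 ∩ {`r_an = 0`}, a bad prime `q` with `3 ∣ c_q`, certificate `(0, 2)`, `hAFE`: Miller's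
`BSD(E, 3)`** through §1's X7 road. PER PAIR; all other inputs PUBLISHED named facts by name.
[cite: Wuthrich2014, Prop. 21 (p. 400)] [cite: Miller2011LMS, Def. 1.1] [cite: BDKim2013, Cor. 3.15 (p. 199)]
[cite: KimBD2008MRL, Thm. 3.12 (p. 93)] [cite: SilvermanAEC2009, Cor. VII.6.2] -/
theorem X7.bsdp_three_of_lam_eq_two_of_dvd_localTamagawa_of_analyticRank_eq_zero_of_afe
    (hW : Wuthrich2014.sha_dvd_analyticSha)
    (h12 : Kobayashi2003.thm12_signedSelmerDual_finite_torsion)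
    (h41 : Kobayashi2003.thm41_signedCharIdeal_divisibility)
    (h5 : realPeriodRat_eq_unit_mul_plusPeriod) (h3 : realPeriodRat_eq_unit_mul_plusPeriod_three)
    (hL20 : Wuthrich2014.lemma20_surjective_threeAdic_of_semistable)
    (hK13 : BDKim2013.cor315_signedCharValue_rankZero)
    (hmod : nonempty_modularParametrizationData) (hmod' : hasEntireLFunction_rat)
    (hGZK : rank_eq_analyticRank_of_analyticRank_le_one)
    [Fact (Nat.Prime 3)] (hX : ClassX7 W 3) (hap : W.frobeniusTrace 3 = 0) (hs : Surj W 3) {ε : ℤˣ}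
    (hAFE : ∀ (κ : ZpExtension ℚ 3) (γ : Field.absoluteGaloisGroup ℚ), κ.IsCyclotomic →
      κ.IsTopGenerator γ → ∀ D : SignedSelmerDualData W κ γ ε,
        Ideal.map (IwasawaAlgebra.invol 3) D.charIdeal = D.charIdeal)
    [NeZero (W.conductorNorm ℤ)] {f₀ : CuspForm (Gamma0 (W.conductorNorm ℤ)) 2} (hf₀ : IsNewformOf W f₀)
    (hcert₀ : ∀ L : IwasawaAlgebra 3, IsSignedPAdicLFunction f₀ 3 ε L → mu L = 0 ∧ lam L = 2)
    (h0 : W.analyticRank = 0)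
    (q : ℕ) [Fact q.Prime] (hq : 3 ∣ (W.baseChange ℚ_[q]).localTamagawaNumber ℤ_[q]) : BSDp W 3 :=
  X7.bsdp_of_lam_eq_two_of_dvd_tamagawa_of_analyticRank_eq_zero_of_afe W 3 hW h12 h41 h5 h3 hL20 hK13 hmod
    hmod' hGZK (by decide) hX hap hs hAFE hf₀ hcert₀ h0
    (three_dvd_tamagawaProduct_of_dvd_localTamagawaNumber W q hq)

/-! ## §3. Records-level forms at an odd `p`: the certificate as ONE Mazur–Tate element -/

variable (p : ℕ) [Fact p.Prime]

/-- **Records-level form, sign `−1` (Kobayashi's `L_p^-` = the tree's `L⁺`, ODD layers), any odd `p`,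
analytic rank `0`, `p ∣ ∏ c_ℓ`**: ONE odd-level Mazur–Tate element `Θ` of the newform `f₀` of level `N_E`
(`ι Θ = θ_n(f₀)`, `Θ ≠ 0`, `μ(Θ) = 0`, `λ(Θ) = deg ω_n^+ + 2`; then `(μ, λ)(L_p^-) = (0, 2)` by
`lam_signed_neg_one_eq_of_mazurTate'`, Pollack Prop. 6.9/6.10, `p` odd) + `hAFE` at `(E, p, −1)` ⇒
`KobayashiMainConjecture W p (−1)`. At `p = 3` this is the bookable shape of the `3 ∣ Tam` rows.
[cite: Pollack2003, Prop. 6.9, 6.10 and 6.18] [cite: Kobayashi2003, Thm. 1.2, Thm. 4.1 and Conjecture (p. 2)]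
[cite: BDKim2013, Cor. 3.15 (p. 199)] [cite: KimBD2008MRL, Thm. 3.12 (p. 93)] -/
theorem kobayashiMainConjecture_neg_one_of_mazurTate_lam_two_of_dvd_tamagawa_of_analyticRank_eq_zero_of_afe
    (h12 : Kobayashi2003.thm12_signedSelmerDual_finite_torsion)
    (h41 : Kobayashi2003.thm41_signedCharIdeal_divisibility)
    (h5 : realPeriodRat_eq_unit_mul_plusPeriod) (h3 : realPeriodRat_eq_unit_mul_plusPeriod_three)
    (hL20 : Wuthrich2014.lemma20_surjective_threeAdic_of_semistable)
    (hK13 : BDKim2013.cor315_signedCharValue_rankZero)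
    (hGZK : rank_eq_analyticRank_of_analyticRank_le_one)
    (hp : p ≠ 2) (hgood : W.HasGoodReductionAtPrime p) (hap : W.frobeniusTrace p = 0) (hs : Surj W p)
    (hAFE : ∀ (κ : ZpExtension ℚ p) (γ : Field.absoluteGaloisGroup ℚ), κ.IsCyclotomic →
      κ.IsTopGenerator γ → ∀ D : SignedSelmerDualData W κ γ (-1),
        Ideal.map (IwasawaAlgebra.invol p) D.charIdeal = D.charIdeal)
    [NeZero (W.conductorNorm ℤ)] {f₀ : CuspForm (Gamma0 (W.conductorNorm ℤ)) 2} (hf₀ : IsNewformOf W f₀)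
    {n : ℕ} (hn : Odd n) {Θ : IwasawaAlgebra p}
    (hΘ : iwasawaToPowerSeries p Θ =
      ((mazurTateElement f₀ p n).map (algebraMap ℚ ℚ_[p]) : PowerSeries ℚ_[p]))
    (hΘ0 : Θ ≠ 0) (hμ : mu Θ = 0) (hlam : lam Θ = (cyclotomicOmegaPlus p n).natDegree + 2)
    (h0 : W.analyticRank = 0) (hdvd : p ∣ W.tamagawaProduct) :
    KobayashiMainConjecture W p (-1) :=
  kobayashiMainConjecture_of_lam_eq_two_of_dvd_tamagawa_of_analyticRank_eq_zero_of_afe W p h12 h41 h5 h3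
    hL20 hK13 hGZK hp hgood hap hs (-1) hAFE hf₀
    (fun _ hL ↦ lam_signed_neg_one_eq_of_mazurTate' hp hf₀ hgood hap hL hn hΘ hΘ0 hμ hlam) h0 hdvd

/-- **Records-level form, sign `1` (Kobayashi's `L_p^+` = the tree's `L⁻`, EVEN layers), any odd `p`,
analytic rank `0`, `p ∣ ∏ c_ℓ`**: `n` even, `λ(Θ) = deg ω_n^- + 2`, otherwise as above ⇒
`KobayashiMainConjecture W p 1`. [cite: Pollack2003, Prop. 6.9, 6.10 and 6.18]
[cite: Kobayashi2003, Thm. 1.2, Thm. 4.1 and Conjecture (p. 2)] [cite: BDKim2013, Cor. 3.15 (p. 199)] -/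
theorem kobayashiMainConjecture_one_of_mazurTate_lam_two_of_dvd_tamagawa_of_analyticRank_eq_zero_of_afe
    (h12 : Kobayashi2003.thm12_signedSelmerDual_finite_torsion)
    (h41 : Kobayashi2003.thm41_signedCharIdeal_divisibility)
    (h5 : realPeriodRat_eq_unit_mul_plusPeriod) (h3 : realPeriodRat_eq_unit_mul_plusPeriod_three)
    (hL20 : Wuthrich2014.lemma20_surjective_threeAdic_of_semistable)
    (hK13 : BDKim2013.cor315_signedCharValue_rankZero)
    (hGZK : rank_eq_analyticRank_of_analyticRank_le_one)
    (hp : p ≠ 2) (hgood : W.HasGoodReductionAtPrime p) (hap : W.frobeniusTrace p = 0) (hs : Surj W p)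
    (hAFE : ∀ (κ : ZpExtension ℚ p) (γ : Field.absoluteGaloisGroup ℚ), κ.IsCyclotomic →
      κ.IsTopGenerator γ → ∀ D : SignedSelmerDualData W κ γ 1,
        Ideal.map (IwasawaAlgebra.invol p) D.charIdeal = D.charIdeal)
    [NeZero (W.conductorNorm ℤ)] {f₀ : CuspForm (Gamma0 (W.conductorNorm ℤ)) 2} (hf₀ : IsNewformOf W f₀)
    {n : ℕ} (hn : Even n) {Θ : IwasawaAlgebra p}
    (hΘ : iwasawaToPowerSeries p Θ =
      ((mazurTateElement f₀ p n).map (algebraMap ℚ ℚ_[p]) : PowerSeries ℚ_[p]))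
    (hΘ0 : Θ ≠ 0) (hμ : mu Θ = 0) (hlam : lam Θ = (cyclotomicOmegaMinus p n).natDegree + 2)
    (h0 : W.analyticRank = 0) (hdvd : p ∣ W.tamagawaProduct) :
    KobayashiMainConjecture W p 1 :=
  kobayashiMainConjecture_of_lam_eq_two_of_dvd_tamagawa_of_analyticRank_eq_zero_of_afe W p h12 h41 h5 h3
    hL20 hK13 hGZK hp hgood hap hs 1 hAFE hf₀
    (fun _ hL ↦ lam_signed_one_eq_of_mazurTate' hp hf₀ hgood hap hL hn hΘ hΘ0 hμ hlam) h0 hdvd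

end Three

end Summit.BirchSwinnertonDyer.BirchSwinnertonDyer.Theorems.LargeImageLambdaTwoStratum

end
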